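/-
Copyright (c) 2026 the pub-hodgecm-mathlib formalisation cell (harness21).  Prover seat hodgecm-mathlib-K2E1-p14 (g3), Track B ∕ K2-LIT, h413 = `stmt-HodgeConjecture-24833`,
R90-TF section S8 «ContSpec-n½», #4′ road, H7 = THE LAST LINK, ED. 1 (S8 dealer R90-CS-plan (g2) S8-R44 2026-09-04T22:24:45Z): the LAYER 2 PRINT ★ p862113 assembled at the κ∕K₀
OF RECORD — density (D) ★ p862396, block exhaustion (E_blk) ★ p862438, the five structural side conditions ★ p862475 and `hc` DISCHARGED; the letters (O), (N_blk), (L) carried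
VISIBLY in the print's shapes at the defs of record `At := resHAtom`, `Ln := resHLine` (★ p862464).
-/
import Summits.HodgeConjecture.HodgeConjecture.Theorems.R90S8ResHLevelFamilySideConditionsU2   -- ★ p862475 (this seat): `residual_le_topologicalClosure_iSup_charLines_of_letters_kad` (side conditions discharged); brings ★ p862113, ★ `isOpen_comap_finAdelicToAdelic_maximalLevel`
import Summits.HodgeConjecture.HodgeConjecture.Theorems.R90S8IsotypicDensityOfLettersU2          -- ★ p862396 (K2E2-p12) (D): `le_topologicalClosure_iSup_inf_iso_of_continuous` (index `Λ′`)
import Summits.HodgeConjecture.HodgeConjecture.Theorems.R90S8PseudoEisensteinBlocksDenseU2       -- ★ p862438 (K2E1-p13) (E_blk) ED. 2: `hEblk_resHAtom_resHLine`; brings ★ DEFS p862464 `resHBlock ∕ resHAtom ∕ resHLine`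
import Summits.HodgeConjecture.HodgeConjecture.Theorems.K2E1BlockHeckeTBLetterFreeCMTwo           -- ★ (K2E1-p11): `compactSpace_archUnitaryPoints` (`K_∞ = U(J₂)(L⁺⊗ℝ) ∩ U(1⊗1)` is compact)
import HarnessLib

/-!
# S8 #4′ road, H7 (LAST LINK) ED. 1 — `R90S8ResHSpannedByCharLinesQuasiSplit`: an irreducible of `L²_res(U(J₂)_{L∕L⁺})` lies in `closure ⨆_ψ ℂ·[ψ∘det]`, MODULO the three letters (O), (N_blk), (L)
# in the print's shapes at `At := resHAtom`, `Ln := resHLine` — (D), (E_blk), the side conditions `hdo hHK′ W hW hP1τ` and `hc` DISCHARGED at the κ∕K₀ OF RECORD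

Track B ∕ K2-LIT, crux h413 = `stmt-HodgeConjecture-24833`, route of record `HCCMUnconditional`; cell `hodgecm-mathlib`, R90-TF programme, section S8 «ContSpec-n½», socket #4′
`sock_S8_resH_spannedByCharLines` (`Lines/R90_S8_ResidualSpectrumU3B.lean`; SURVIVES ruling Q-S1 as the `ξ_H` source term).  THEOREMS ONLY (no `def`, no `instance`, no `notation`, no
named-fact hypothesis, no `sorry`; default heartbeats); lane `--supports stmt-HodgeConjecture-24833 --as helper` (count-neutral).  CLOSES NO SOCKET: ED. 1 carries (O) `hO`, (N_blk) `hN`,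
(L) `hL` VISIBLY (creditors: ★ K2E1-p15 `isOrtho_iSup_resHAtom_iSup_resHLine_of_letters′`, ★ p862453 R90-C133-p02 `resH_isotypic_le_orthogonal_of_lineModel` (+ ED. 2 §3), K2E2-p12 (L)
`R90S8ResHResiduesAreCharLinesU2`); ED. 2∕3 are append-only swaps of each visible letter for its creditor's head; B ED. 5's `exact resH_spannedByCharLines_of_quasiSplit …` (★ p862226) waits
for the letter-free edition.

THE ASSEMBLY ([MoeglinWaldspurger1995, I.2.18, II.2.4, V.3.13, VI.2]; [Rogawski1990, §13.9 p. 229]; [BorelJacquet1979, §4.1]).  κ OF RECORD (S8-R34): `K_∞ := U(J₂)(L⁺⊗ℝ) ∩ U(1⊗1)` embedded by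
`Subgroup.inclusion inf_le_left` (injective, continuous); K₀ OF RECORD: the finite trace `ι_f⁻¹(K_M1)` of `K_M1 = adelicVal⁻¹(K_∞·GL₂(𝒪̂_L))` (open, ★ `isOpen_comap_finAdelicToAdelic_maximalLevel`;
its members are integral).  (D) ★ `le_topologicalClosure_iSup_inf_iso_of_continuous` gives `P ≤ closure ⨆_{ℓ ∈ Λ′} P ⊓ Iso(Kad(K′_f), ω̃)` over
`Λ′ = Σ (K′_f ≤ K₀ open) (χ ∈ K̂_∞) {ω̃ ∣ generator values, unitary, continuous}`; it needs `K_∞` to be a compact Hausdorff ABELIAN topological group — compact is ★ `compactSpace_archUnitaryPoints`,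
and ABELIAN is §0 of this file: `g ∈ U(J₂) ∩ U(1⊗1)` has `(σg)ᵀ = g⁻¹`, so `g` commutes with `J₂ ⊗ 1 = antidiag(1,1)`, so `g = [[a,b],[b,a]]`, and two such matrices commute (entries in the
commutative ring `L ⊗ ℝ`); the `CommGroup` structure is assembled INSIDE the proof (no instance is declared).  Hence `Λ′` (which mentions `K̂_∞ = PontryaginDual K_∞`) cannot occur in a
statement, and the VISIBLE letters are quantified over the instance-free index OF RECORD (S8-R50) `ι₀ = {(K′_f, ω) ∣ K′_f ≤ K₀ open, ω : Kad(K′_f) →* ℂ unitary continuous}` READ CURRIED —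
`∀ K′_f, IsOpen K′_f → K′_f ≤ K₀ → ∀ ω, (∀ x, ‖ω x‖ = 1) → Continuous ω → …` — so that at `ℓ ∈ Λ′` every letter instantiates by six projections and every type matches SYNTACTICALLY (no `Σ`-repacking;
the bare block-model family `U K′_f ω b` is total data over all `(K′_f, ω)`).  Then ★ `residual_le_topologicalClosure_iSup_charLines_of_letters_kad` (side conditions and `hc` discharged) at
`ι := Λ′`, `Kf ℓ := ℓ.1.1` (open, `⊆ GL₂(𝒪̂)` from `≤ K₀`), `ω ℓ := ℓ.2.2.1` (unitary, continuous: the `Λ′` clauses), `At ℓ b := resHAtom L μ (U ℓ.1.1 ℓ.2.2.1 b) …`, `Ln ℓ b := resHLine …`,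
`hD` := (D), `hEblk` := ★ `hEblk_resHAtom_resHLine`, and `hO hN hL` := the visible letters at `(ℓ.1.1, ℓ.2.2.1)` with their four premises read off `ℓ`.
* §0 `mul_comm_of_commute_antidiag`, `commute_of_mul_eq_one_of_conj_eq`, `archFormOf_antidiagonal_two_apply`, **`archUnitaryPoints_mul_comm`** (generic quadratic datum, N = 2).
* §1 `coe_mem_glFiniteIntegralLevel_of_mem_maximalLevelFin` (K₀ ⊆ GL₂(𝒪̂)), `continuous_inclusion_archUnitaryPoints`.
* §2 **`resH_spannedByCharLines_of_letters_quasiSplit`** — THE HEAD (ED. 1).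
HONEST LABEL: HC_CM is proved only modulo the 7 printed citations (2 remaining named inputs: hLiu418 = `stmt-HodgeConjecture-24832`, h413 = `stmt-HodgeConjecture-24833`) until
rung 0 closes; REL ≠ ★ ≠ BUILT; this file asserts no named fact, is conditional by construction on the visible letters (O)(N_blk)(L) and the bare block-model family `U`, and closes no
socket (#4′ stays OPEN); count-neutral.  ONE SHAPE DELTA vs ★ p862226's `H`: the bridge binder `hne : Nonempty 𝔓.ι` (the letter-free edition case-splits, or the socket supplies it).

## References
* [MoeglinWaldspurger1995] C. Mœglin, J.-L. Waldspurger, *Spectral Decomposition and Eisenstein Series* (1995), I.2.18, II.2.4, V.3.13, VI.2.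
* [Rogawski1990] J. D. Rogawski, *Automorphic Representations of Unitary Groups in Three Variables* (1990), §13.9 p. 229.
* [BorelJacquet1979] A. Borel, H. Jacquet, *Automorphic forms and automorphic representations*, Corvallis PSPM 33.1 (1979), §4.1.
-/

set_option autoImplicit false
set_option linter.dupNamespace false  -- the mandated namespace `…HodgeConjecture.HodgeConjecture.R90.S8` (LEAD #1 L1) repeats the summit's segment

noncomputable section

open MeasureTheory Measure Set Filter Topology NumberField NumberField.mixedEmbedding IsDedekindDomain
open Literature.MeasureTheory.Group Literature.NumberTheory.Automorphic Literature.NumberTheory.Automorphic.UnitaryGroup Literature.NumberTheory.GaloisRepresentations AdelicGroupData ContRepresentation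
open Literature.NumberTheory.Automorphic.Arthur2013.Leaves.TECR
open Summit.HodgeConjecture.HodgeConjecture.Cruxes.H413.K2E1BorelEisensteinU
open Summit.HodgeConjecture.HodgeConjecture.Cruxes.H413.K2E1CharacterEisensteinU2Defs
open Summit.HodgeConjecture.HodgeConjecture.Cruxes.H413.K2E1ChiSectionSpaceU2Defs
open Summit.HodgeConjecture.HodgeConjecture.Cruxes.H413.K2E1DoubleCosetsOpenArchLevelU2 (isOpen_comap_finAdelicToAdelic_maximalLevel)
open Summit.HodgeConjecture.HodgeConjecture.Cruxes.H413.K2E1BlockHeckeTBLetterFreeCMTwo (compactSpace_archUnitaryPoints)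
open Summit.HodgeConjecture.HodgeConjecture.Cruxes.H413.K2E1CuspidalSpectrumUnitary (residualSubspace)
open scoped ENNReal NNReal Pointwise

namespace Summit.HodgeConjecture.HodgeConjecture.R90.S8

/-! ## §0 `K_∞ = U(J₂)(E ⊗ ℝ) ∩ U(1 ⊗ 1)` is ABELIAN (every quadratic datum `(F, E, c)`, rank 2) -/

section KInfAbelian

/-- **Two `2 × 2` matrices over a commutative ring that both commute with `antidiag(1,1)` commute with each other**: commuting with `antidiag(1,1)` forces the shape `[[a,b],[b,a]]`, and
such matrices form a commutative algebra (`span{1, antidiag(1,1)}`). [folklore] -/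
theorem mul_comm_of_commute_antidiag {R : Type*} [CommRing R] (A G H : Matrix (Fin 2) (Fin 2) R)
    (hA : ∀ i j : Fin 2, A i j = if j = i.rev then 1 else 0) (hG : A * G = G * A) (hH : A * H = H * A) : G * H = H * G := by
  have hA00 : A 0 0 = 0 := by rw [hA, if_neg (by decide)]
  have hA01 : A 0 1 = 1 := by rw [hA, if_pos (by decide)]
  have hA10 : A 1 0 = 1 := by rw [hA, if_pos (by decide)]
  have hA11 : A 1 1 = 0 := by rw [hA, if_neg (by decide)]
  have key : ∀ M : Matrix (Fin 2) (Fin 2) R, A * M = M * A → M 1 0 = M 0 1 ∧ M 1 1 = M 0 0 := by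
    intro M hM
    have h00 := congrFun (congrFun hM 0) 0
    have h01 := congrFun (congrFun hM 0) 1
    simp only [Matrix.mul_apply, Fin.sum_univ_two, hA00, hA01, hA10, hA11, zero_mul, one_mul, mul_zero, mul_one, zero_add, add_zero] at h00 h01
    exact ⟨h00, h01⟩
  obtain ⟨hG10, hG11⟩ := key G hG
  obtain ⟨hH10, hH11⟩ := key H hH
  ext i j
  fin_cases i <;> fin_cases j <;>
    simp only [Matrix.mul_apply, Fin.sum_univ_two, Fin.zero_eta, Fin.mk_one, hG10, hG11, hH10, hH11] <;> ring

/-- **`S·G = 1` and `S·A·G = A` ⟹ `A·G = G·A`** (square matrices over a commutative ring: `G·S = 1` as well, Mathlib `mul_eq_one_comm`). [folklore] -/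
theorem commute_of_mul_eq_one_of_conj_eq {R : Type*} [CommRing R] {n : Type*} [Fintype n] [DecidableEq n] (S A G : Matrix n n R)
    (h1 : S * G = 1) (hA : S * A * G = A) : A * G = G * A := by
  have h2 : G * S = 1 := mul_eq_one_comm.1 h1
  calc A * G = (G * S) * A * G := by rw [h2, Matrix.one_mul]
    _ = G * (S * A * G) := by simp only [Matrix.mul_assoc]
    _ = G * A := by rw [hA]

variable {F E : Type} [Field F] [Field E] [Algebra F E] {c : E ≃ₐ[F] E}

/-- **Entries of the archimedean form `J₂ ⊗ 1 = antidiag(1,1)`** (`archFormOf E 2 ((antidiagonal 2).over E)`). [folklore] -/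
theorem archFormOf_antidiagonal_two_apply (i j : Fin 2) :
    archFormOf E 2 ((StdForm.antidiagonal 2).over E) i j = if j = i.rev then 1 else 0 := by
  simp only [archFormOf, StdForm.over, Matrix.map_apply, StdForm.antidiagonal_J_apply]
  split_ifs <;> simp

/-- **`K_∞ = U(J₂)(E ⊗ ℝ) ∩ U(1 ⊗ 1)` IS COMMUTATIVE** (rank 2, every quadratic datum `(F, E, c)`): for `g` in both unitary groups `(σg)ᵀ·g = 1` and `(σg)ᵀ·(J₂⊗1)·g = J₂⊗1`, so `g` commutes with
`antidiag(1,1)` (`commute_of_mul_eq_one_of_conj_eq`), whence any two elements commute (`mul_comm_of_commute_antidiag`).  This is the `[CommGroup K_∞]` input of ★ (D)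
`le_topologicalClosure_iSup_inf_iso_of_continuous` at the κ OF RECORD, assembled as a structure INSIDE §2's proof. [cite: BorelJacquet1979, §4.1] -/
theorem archUnitaryPoints_mul_comm (g h : ↥(arch F E c 2 ((StdForm.antidiagonal 2).over E) ⊓ unitaryGroupOfForm (conjMixed F E c) 1)) : g * h = h * g := by
  have hcomm : ∀ k : ↥(arch F E c 2 ((StdForm.antidiagonal 2).over E) ⊓ unitaryGroupOfForm (conjMixed F E c) 1),
      archFormOf E 2 ((StdForm.antidiagonal 2).over E) * ((k : GL (Fin 2) (mixedSpace E)) : Matrix (Fin 2) (Fin 2) (mixedSpace E)) =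
        ((k : GL (Fin 2) (mixedSpace E)) : Matrix (Fin 2) (Fin 2) (mixedSpace E)) * archFormOf E 2 ((StdForm.antidiagonal 2).over E) := by
    intro k
    have hkA := (mem_arch_iff F E c 2 ((StdForm.antidiagonal 2).over E) _).1 k.2.1
    have hk1 := mem_unitaryGroupOfForm_iff.1 k.2.2
    rw [Matrix.mul_one] at hk1
    exact commute_of_mul_eq_one_of_conj_eq _ _ _ hk1 hkA
  have hmat : ((g : GL (Fin 2) (mixedSpace E)) : Matrix (Fin 2) (Fin 2) (mixedSpace E)) * ((h : GL (Fin 2) (mixedSpace E)) : Matrix (Fin 2) (Fin 2) (mixedSpace E)) =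
      ((h : GL (Fin 2) (mixedSpace E)) : Matrix (Fin 2) (Fin 2) (mixedSpace E)) * ((g : GL (Fin 2) (mixedSpace E)) : Matrix (Fin 2) (Fin 2) (mixedSpace E)) :=
    mul_comm_of_commute_antidiag _ _ _ (archFormOf_antidiagonal_two_apply (E := E)) (hcomm g) (hcomm h)
  exact Subtype.ext (Units.ext (by simpa using hmat))

end KInfAbelian

/-! ## §1 K₀ OF RECORD: its members are integral; the κ OF RECORD is continuous -/

section CMTwo

variable (L : Type) [Field L] [NumberField L] [IsCMField L]
  (μ : Measure (quasiSplit (↥(maximalRealSubfield L)) L (IsCMField.complexConj L) 2).automorphicQuotient)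

/-- **K₀ OF RECORD ⊆ GL₂(𝒪̂_L)**: a finite-adelic point whose image lies in `K_M1 = adelicVal⁻¹(K_∞·GL₂(𝒪̂_L))` is integral (★ `mem_standardMaximalCompactGL_iff_toMixed_sndHom`, `GLn.sndHom_ofFinite`).
[cite: BorelJacquet1979, §4.1] -/
theorem coe_mem_glFiniteIntegralLevel_of_mem_maximalLevelFin (u : ↥(finAdelic (↥(maximalRealSubfield L)) L (IsCMField.complexConj L) 2 ((StdForm.antidiagonal 2).over L))) (hu : u ∈ ((((standardMaximalCompactGL 2 L).comap (adelicVal (↥(maximalRealSubfield L)) L (IsCMField.complexConj L) 2 ((StdForm.antidiagonal 2).over L)) : Subgroup (quasiSplit (↥(maximalRealSubfield L)) L (IsCMField.complexConj L) 2).Adelic)).comap (finAdelicToAdelic (↥(maximalRealSubfield L)) L (IsCMField.complexConj L) 2 ((StdForm.antidiagonal 2).over L)) : Subgroup ↥(finAdelic (↥(maximalRealSubfield L)) L (IsCMField.complexConj L) 2 ((StdForm.antidiagonal 2).over L)))) :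
    ((u : ↥(finAdelic (↥(maximalRealSubfield L)) L (IsCMField.complexConj L) 2 ((StdForm.antidiagonal 2).over L))) : GL (Fin 2) (FiniteAdeleRing (𝓞 L) L)) ∈ glFiniteIntegralLevel 2 L := by
  have h := Subgroup.mem_comap.1 (Subgroup.mem_comap.1 hu)
  rw [adelicVal_finAdelicToAdelic, mem_standardMaximalCompactGL_iff_toMixed_sndHom, GLn.sndHom_ofFinite] at h
  exact h.2

/-- **The κ OF RECORD `K_∞ ↪ U(J₂)(L⁺ ⊗ ℝ)` is continuous** (subspace topologies). [folklore] -/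
theorem continuous_inclusion_archUnitaryPoints : Continuous (Subgroup.inclusion (inf_le_left : (UnitaryGroup.arch (↥(maximalRealSubfield L)) L (IsCMField.complexConj L) 2 ((StdForm.antidiagonal 2).over L) ⊓ unitaryGroupOfForm (conjMixed (↥(maximalRealSubfield L)) L (IsCMField.complexConj L)) 1) ≤ UnitaryGroup.arch (↥(maximalRealSubfield L)) L (IsCMField.complexConj L) 2 ((StdForm.antidiagonal 2).over L))) :=
  continuous_induced_rng.2 continuous_subtype_val

/-! ## §2 THE HEAD (ED. 1): the LAYER 2 PRINT assembled at the κ∕K₀ OF RECORD, modulo (O), (N_blk), (L) -/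

/-- **H7 ED. 1 — AN IRREDUCIBLE OF `L²_res(U(J₂)_{L∕L⁺})` LIES IN `closure ⨆_ψ ℂ·[ψ∘det]`, MODULO (O), (N_blk), (L).**  Binders: a NAMED Borel datum `𝔓` (`hne`, `h𝔓`); a bare (total) block-model
family `U K′_f ω b : L² →ₗ[ℂ] A K′_f ω b × Λ K′_f ω b` over the finite levels `K′_f`, the characters `ω : Kad(K′_f) →* ℂ` and the print's block index; the VISIBLE LETTERS, for every
`K′_f ≤ K₀` open and every unitary continuous `ω` (index of record, curried), in the print's shapes at `At := resHAtom L μ (U K′_f ω b) (Kad K′_f) ω ↑b`, `Ln := resHLine …`: (O) `hO` (creditor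
★ K2E1-p15), (N_blk) `hN` (creditor ★ p862453 + its ED. 2), (L) `hL` (creditor K2E2-p12); an irreducible closed `P ≤ L²_res(𝔓)`.  DISCHARGED inside: `hc`; the side conditions (★ p862475); (E_blk) (★ `hEblk_resHAtom_resHLine`); (D) (★ `le_topologicalClosure_iSup_inf_iso_of_continuous` at
κ∕K₀ OF RECORD, `K_∞` compact ★ and abelian §0, over `Λ′`, the letters read at `(ℓ.1.1, ℓ.2.2.1)`).  Conclusion = ★ p862113's ∕ ★ p862226 `H`'s body.
[cite: MoeglinWaldspurger1995, I.2.18, II.2.4, V.3.13, VI.2] [cite: Rogawski1990, §13.9 p. 229] [cite: BorelJacquet1979, §4.1] -/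
theorem resH_spannedByCharLines_of_letters_quasiSplit
    (𝔓 : (quasiSplit (↥(maximalRealSubfield L)) L (IsCMField.complexConj L) 2).ParabolicUnipotentData) (hne : Nonempty 𝔓.ι) (h𝔓 : ∀ i : 𝔓.ι, 𝔓.radical i = adelicUnipotent (↥(maximalRealSubfield L)) L (IsCMField.complexConj L) 2)
    [MeasurableSpace (quasiSplit (↥(maximalRealSubfield L)) L (IsCMField.complexConj L) 2).Adelic] [BorelSpace (quasiSplit (↥(maximalRealSubfield L)) L (IsCMField.complexConj L) 2).Adelic] [(quasiSplit (↥(maximalRealSubfield L)) L (IsCMField.complexConj L) 2).IsAutomorphicMeasure μ]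
    {A Λ : ∀ (Kf : Subgroup ↥(finAdelic (↥(maximalRealSubfield L)) L (IsCMField.complexConj L) 2 ((StdForm.antidiagonal 2).over L))) (ω : ↥(Subgroup.closure ((Set.range (fun k : ↥(UnitaryGroup.arch (↥(maximalRealSubfield L)) L (IsCMField.complexConj L) 2 ((StdForm.antidiagonal 2).over L) ⊓ unitaryGroupOfForm (conjMixed (↥(maximalRealSubfield L)) L (IsCMField.complexConj L)) 1) => (archToAdelic (↥(maximalRealSubfield L)) L (IsCMField.complexConj L) 2 ((StdForm.antidiagonal 2).over L)) (Subgroup.inclusion inf_le_left k)) ∪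
            (finAdelicToAdelic (↥(maximalRealSubfield L)) L (IsCMField.complexConj L) 2 ((StdForm.antidiagonal 2).over L)) '' ((Kf : Subgroup ↥(finAdelic (↥(maximalRealSubfield L)) L (IsCMField.complexConj L) 2 ((StdForm.antidiagonal 2).over L))) : Set ↥(finAdelic (↥(maximalRealSubfield L)) L (IsCMField.complexConj L) 2 ((StdForm.antidiagonal 2).over L)))) : Set (quasiSplit (↥(maximalRealSubfield L)) L (IsCMField.complexConj L) 2).Adelic)) →* ℂ), ↥{χ : HeckeCharacter L | (∀ r : ℝ≥0ˣ, χ (posRealIdele L r) = 1) ∧ chiSectionSpace χ (Subgroup.closure ((Set.range (fun k : ↥(UnitaryGroup.arch (↥(maximalRealSubfield L)) L (IsCMField.complexConj L) 2 ((StdForm.antidiagonal 2).over L) ⊓ unitaryGroupOfForm (conjMixed (↥(maximalRealSubfield L)) L (IsCMField.complexConj L)) 1) => (archToAdelic (↥(maximalRealSubfield L)) L (IsCMField.complexConj L) 2 ((StdForm.antidiagonal 2).over L)) (Subgroup.inclusion inf_le_left k)) ∪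
            (finAdelicToAdelic (↥(maximalRealSubfield L)) L (IsCMField.complexConj L) 2 ((StdForm.antidiagonal 2).over L)) '' ((Kf : Subgroup ↥(finAdelic (↥(maximalRealSubfield L)) L (IsCMField.complexConj L) 2 ((StdForm.antidiagonal 2).over L))) : Set ↥(finAdelic (↥(maximalRealSubfield L)) L (IsCMField.complexConj L) 2 ((StdForm.antidiagonal 2).over L)))) : Set (quasiSplit (↥(maximalRealSubfield L)) L (IsCMField.complexConj L) 2).Adelic)) ((ω) : ↥(Subgroup.closure ((Set.range (fun k : ↥(UnitaryGroup.arch (↥(maximalRealSubfield L)) L (IsCMField.complexConj L) 2 ((StdForm.antidiagonal 2).over L) ⊓ unitaryGroupOfForm (conjMixed (↥(maximalRealSubfield L)) L (IsCMField.complexConj L)) 1) => (archToAdelic (↥(maximalRealSubfield L)) L (IsCMField.complexConj L) 2 ((StdForm.antidiagonal 2).over L)) (Subgroup.inclusion inf_le_left k)) ∪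
            (finAdelicToAdelic (↥(maximalRealSubfield L)) L (IsCMField.complexConj L) 2 ((StdForm.antidiagonal 2).over L)) '' ((Kf : Subgroup ↥(finAdelic (↥(maximalRealSubfield L)) L (IsCMField.complexConj L) 2 ((StdForm.antidiagonal 2).over L))) : Set ↥(finAdelic (↥(maximalRealSubfield L)) L (IsCMField.complexConj L) 2 ((StdForm.antidiagonal 2).over L)))) : Set (quasiSplit (↥(maximalRealSubfield L)) L (IsCMField.complexConj L) 2).Adelic)) → ℂ) ≠ ⊥} → Type*}
    [∀ Kf ω b, AddCommGroup (A Kf ω b)] [∀ Kf ω b, Module ℂ (A Kf ω b)] [∀ Kf ω b, AddCommGroup (Λ Kf ω b)] [∀ Kf ω b, Module ℂ (Λ Kf ω b)]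
    (U : ∀ (Kf : Subgroup ↥(finAdelic (↥(maximalRealSubfield L)) L (IsCMField.complexConj L) 2 ((StdForm.antidiagonal 2).over L))) (ω : ↥(Subgroup.closure ((Set.range (fun k : ↥(UnitaryGroup.arch (↥(maximalRealSubfield L)) L (IsCMField.complexConj L) 2 ((StdForm.antidiagonal 2).over L) ⊓ unitaryGroupOfForm (conjMixed (↥(maximalRealSubfield L)) L (IsCMField.complexConj L)) 1) => (archToAdelic (↥(maximalRealSubfield L)) L (IsCMField.complexConj L) 2 ((StdForm.antidiagonal 2).over L)) (Subgroup.inclusion inf_le_left k)) ∪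
            (finAdelicToAdelic (↥(maximalRealSubfield L)) L (IsCMField.complexConj L) 2 ((StdForm.antidiagonal 2).over L)) '' ((Kf : Subgroup ↥(finAdelic (↥(maximalRealSubfield L)) L (IsCMField.complexConj L) 2 ((StdForm.antidiagonal 2).over L))) : Set ↥(finAdelic (↥(maximalRealSubfield L)) L (IsCMField.complexConj L) 2 ((StdForm.antidiagonal 2).over L)))) : Set (quasiSplit (↥(maximalRealSubfield L)) L (IsCMField.complexConj L) 2).Adelic)) →* ℂ) (b : ↥{χ : HeckeCharacter L | (∀ r : ℝ≥0ˣ, χ (posRealIdele L r) = 1) ∧ chiSectionSpace χ (Subgroup.closure ((Set.range (fun k : ↥(UnitaryGroup.arch (↥(maximalRealSubfield L)) L (IsCMField.complexConj L) 2 ((StdForm.antidiagonal 2).over L) ⊓ unitaryGroupOfForm (conjMixed (↥(maximalRealSubfield L)) L (IsCMField.complexConj L)) 1) => (archToAdelic (↥(maximalRealSubfield L)) L (IsCMField.complexConj L) 2 ((StdForm.antidiagonal 2).over L)) (Subgroup.inclusion inf_le_left k)) ∪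
            (finAdelicToAdelic (↥(maximalRealSubfield L)) L (IsCMField.complexConj L) 2 ((StdForm.antidiagonal 2).over L)) '' ((Kf : Subgroup ↥(finAdelic (↥(maximalRealSubfield L)) L (IsCMField.complexConj L) 2 ((StdForm.antidiagonal 2).over L))) : Set ↥(finAdelic (↥(maximalRealSubfield L)) L (IsCMField.complexConj L) 2 ((StdForm.antidiagonal 2).over L)))) : Set (quasiSplit (↥(maximalRealSubfield L)) L (IsCMField.complexConj L) 2).Adelic)) ((ω) : ↥(Subgroup.closure ((Set.range (fun k : ↥(UnitaryGroup.arch (↥(maximalRealSubfield L)) L (IsCMField.complexConj L) 2 ((StdForm.antidiagonal 2).over L) ⊓ unitaryGroupOfForm (conjMixed (↥(maximalRealSubfield L)) L (IsCMField.complexConj L)) 1) => (archToAdelic (↥(maximalRealSubfield L)) L (IsCMField.complexConj L) 2 ((StdForm.antidiagonal 2).over L)) (Subgroup.inclusion inf_le_left k)) ∪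
            (finAdelicToAdelic (↥(maximalRealSubfield L)) L (IsCMField.complexConj L) 2 ((StdForm.antidiagonal 2).over L)) '' ((Kf : Subgroup ↥(finAdelic (↥(maximalRealSubfield L)) L (IsCMField.complexConj L) 2 ((StdForm.antidiagonal 2).over L))) : Set ↥(finAdelic (↥(maximalRealSubfield L)) L (IsCMField.complexConj L) 2 ((StdForm.antidiagonal 2).over L)))) : Set (quasiSplit (↥(maximalRealSubfield L)) L (IsCMField.complexConj L) 2).Adelic)) → ℂ) ≠ ⊥}), (quasiSplit (↥(maximalRealSubfield L)) L (IsCMField.complexConj L) 2).L2 μ →ₗ[ℂ] A Kf ω b × Λ Kf ω b)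
    (hO : ∀ (Kf : Subgroup ↥(finAdelic (↥(maximalRealSubfield L)) L (IsCMField.complexConj L) 2 ((StdForm.antidiagonal 2).over L))), IsOpen ((Kf : Subgroup ↥(finAdelic (↥(maximalRealSubfield L)) L (IsCMField.complexConj L) 2 ((StdForm.antidiagonal 2).over L))) : Set ↥(finAdelic (↥(maximalRealSubfield L)) L (IsCMField.complexConj L) 2 ((StdForm.antidiagonal 2).over L))) → Kf ≤ ((((standardMaximalCompactGL 2 L).comap (adelicVal (↥(maximalRealSubfield L)) L (IsCMField.complexConj L) 2 ((StdForm.antidiagonal 2).over L)) : Subgroup (quasiSplit (↥(maximalRealSubfield L)) L (IsCMField.complexConj L) 2).Adelic)).comap (finAdelicToAdelic (↥(maximalRealSubfield L)) L (IsCMField.complexConj L) 2 ((StdForm.antidiagonal 2).over L)) : Subgroup ↥(finAdelic (↥(maximalRealSubfield L)) L (IsCMField.complexConj L) 2 ((StdForm.antidiagonal 2).over L))) → ∀ (ω : ↥(Subgroup.closure ((Set.range (fun k : ↥(UnitaryGroup.arch (↥(maximalRealSubfield L)) L (IsCMField.complexConj L) 2 ((StdForm.antidiagonal 2).over L) ⊓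 unitaryGroupOfForm (conjMixed (↥(maximalRealSubfield L)) L (IsCMField.complexConj L)) 1) => (archToAdelic (↥(maximalRealSubfield L)) L (IsCMField.complexConj L) 2 ((StdForm.antidiagonal 2).over L)) (Subgroup.inclusion inf_le_left k)) ∪
            (finAdelicToAdelic (↥(maximalRealSubfield L)) L (IsCMField.complexConj L) 2 ((StdForm.antidiagonal 2).over L)) '' ((Kf : Subgroup ↥(finAdelic (↥(maximalRealSubfield L)) L (IsCMField.complexConj L) 2 ((StdForm.antidiagonal 2).over L))) : Set ↥(finAdelic (↥(maximalRealSubfield L)) L (IsCMField.complexConj L) 2 ((StdForm.antidiagonal 2).over L)))) : Set (quasiSplit (↥(maximalRealSubfield L)) L (IsCMField.complexConj L) 2).Adelic)) →* ℂ), (∀ x, ‖ω x‖ = 1) → Continuous ω →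
      (⨆ b, resHAtom L μ (U Kf ω b) (Subgroup.closure ((Set.range (fun k : ↥(UnitaryGroup.arch (↥(maximalRealSubfield L)) L (IsCMField.complexConj L) 2 ((StdForm.antidiagonal 2).over L) ⊓ unitaryGroupOfForm (conjMixed (↥(maximalRealSubfield L)) L (IsCMField.complexConj L)) 1) => (archToAdelic (↥(maximalRealSubfield L)) L (IsCMField.complexConj L) 2 ((StdForm.antidiagonal 2).over L)) (Subgroup.inclusion inf_le_left k)) ∪
            (finAdelicToAdelic (↥(maximalRealSubfield L)) L (IsCMField.complexConj L) 2 ((StdForm.antidiagonal 2).over L)) '' ((Kf : Subgroup ↥(finAdelic (↥(maximalRealSubfield L)) L (IsCMField.complexConj L) 2 ((StdForm.antidiagonal 2).over L))) : Set ↥(finAdelic (↥(maximalRealSubfield L)) L (IsCMField.complexConj L) 2 ((StdForm.antidiagonal 2).over L)))) : Set (quasiSplit (↥(maximalRealSubfield L)) L (IsCMField.complexConj L) 2).Adelic)) ω (b : HeckeCharacter L)) ⟂ (⨆ b, resHLine L μ (U Kf ω b) (Subgroup.closure ((Set.range (fun k : ↥(UnitaryGroup.arch (↥(maximalRealSubfield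 L)) L (IsCMField.complexConj L) 2 ((StdForm.antidiagonal 2).over L) ⊓ unitaryGroupOfForm (conjMixed (↥(maximalRealSubfield L)) L (IsCMField.complexConj L)) 1) => (archToAdelic (↥(maximalRealSubfield L)) L (IsCMField.complexConj L) 2 ((StdForm.antidiagonal 2).over L)) (Subgroup.inclusion inf_le_left k)) ∪
            (finAdelicToAdelic (↥(maximalRealSubfield L)) L (IsCMField.complexConj L) 2 ((StdForm.antidiagonal 2).over L)) '' ((Kf : Subgroup ↥(finAdelic (↥(maximalRealSubfield L)) L (IsCMField.complexConj L) 2 ((StdForm.antidiagonal 2).over L))) : Set ↥(finAdelic (↥(maximalRealSubfield L)) L (IsCMField.complexConj L) 2 ((StdForm.antidiagonal 2).over L)))) : Set (quasiSplit (↥(maximalRealSubfield L)) L (IsCMField.complexConj L) 2).Adelic)) ω (b : HeckeCharacter L)))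
    (hN : ∀ (Kf : Subgroup ↥(finAdelic (↥(maximalRealSubfield L)) L (IsCMField.complexConj L) 2 ((StdForm.antidiagonal 2).over L))), IsOpen ((Kf : Subgroup ↥(finAdelic (↥(maximalRealSubfield L)) L (IsCMField.complexConj L) 2 ((StdForm.antidiagonal 2).over L))) : Set ↥(finAdelic (↥(maximalRealSubfield L)) L (IsCMField.complexConj L) 2 ((StdForm.antidiagonal 2).over L))) → Kf ≤ ((((standardMaximalCompactGL 2 L).comap (adelicVal (↥(maximalRealSubfield L)) L (IsCMField.complexConj L) 2 ((StdForm.antidiagonal 2).over L)) : Subgroup (quasiSplit (↥(maximalRealSubfield L)) L (IsCMField.complexConj L) 2).Adelic)).comap (finAdelicToAdelic (↥(maximalRealSubfield L)) L (IsCMField.complexConj L) 2 ((StdForm.antidiagonal 2).over L)) : Subgroup ↥(finAdelic (↥(maximalRealSubfield L)) L (IsCMField.complexConj L) 2 ((StdForm.antidiagonal 2).over L))) → ∀ (ω : ↥(Subgroup.closure ((Set.range (fun k : ↥(UnitaryGroup.arch (↥(maximalRealSubfield L)) L (IsCMField.complexConj L) 2 ((StdForm.antidiagonal 2).over L) ⊓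 unitaryGroupOfForm (conjMixed (↥(maximalRealSubfield L)) L (IsCMField.complexConj L)) 1) => (archToAdelic (↥(maximalRealSubfield L)) L (IsCMField.complexConj L) 2 ((StdForm.antidiagonal 2).over L)) (Subgroup.inclusion inf_le_left k)) ∪
            (finAdelicToAdelic (↥(maximalRealSubfield L)) L (IsCMField.complexConj L) 2 ((StdForm.antidiagonal 2).over L)) '' ((Kf : Subgroup ↥(finAdelic (↥(maximalRealSubfield L)) L (IsCMField.complexConj L) 2 ((StdForm.antidiagonal 2).over L))) : Set ↥(finAdelic (↥(maximalRealSubfield L)) L (IsCMField.complexConj L) 2 ((StdForm.antidiagonal 2).over L)))) : Set (quasiSplit (↥(maximalRealSubfield L)) L (IsCMField.complexConj L) 2).Adelic)) →* ℂ), (∀ x, ‖ω x‖ = 1) → Continuous ω →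
      ∀ (b : ↥{χ : HeckeCharacter L | (∀ r : ℝ≥0ˣ, χ (posRealIdele L r) = 1) ∧ chiSectionSpace χ (Subgroup.closure ((Set.range (fun k : ↥(UnitaryGroup.arch (↥(maximalRealSubfield L)) L (IsCMField.complexConj L) 2 ((StdForm.antidiagonal 2).over L) ⊓ unitaryGroupOfForm (conjMixed (↥(maximalRealSubfield L)) L (IsCMField.complexConj L)) 1) => (archToAdelic (↥(maximalRealSubfield L)) L (IsCMField.complexConj L) 2 ((StdForm.antidiagonal 2).over L)) (Subgroup.inclusion inf_le_left k)) ∪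
            (finAdelicToAdelic (↥(maximalRealSubfield L)) L (IsCMField.complexConj L) 2 ((StdForm.antidiagonal 2).over L)) '' ((Kf : Subgroup ↥(finAdelic (↥(maximalRealSubfield L)) L (IsCMField.complexConj L) 2 ((StdForm.antidiagonal 2).over L))) : Set ↥(finAdelic (↥(maximalRealSubfield L)) L (IsCMField.complexConj L) 2 ((StdForm.antidiagonal 2).over L)))) : Set (quasiSplit (↥(maximalRealSubfield L)) L (IsCMField.complexConj L) 2).Adelic)) ((ω) : ↥(Subgroup.closure ((Set.range (fun k : ↥(UnitaryGroup.arch (↥(maximalRealSubfield L)) L (IsCMField.complexConj L) 2 ((StdForm.antidiagonal 2).over L) ⊓ unitaryGroupOfForm (conjMixed (↥(maximalRealSubfield L)) L (IsCMField.complexConj L)) 1) => (archToAdelic (↥(maximalRealSubfield L)) L (IsCMField.complexConj L) 2 ((StdForm.antidiagonal 2).over L)) (Subgroup.inclusion inf_le_left k)) ∪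
            (finAdelicToAdelic (↥(maximalRealSubfield L)) L (IsCMField.complexConj L) 2 ((StdForm.antidiagonal 2).over L)) '' ((Kf : Subgroup ↥(finAdelic (↥(maximalRealSubfield L)) L (IsCMField.complexConj L) 2 ((StdForm.antidiagonal 2).over L))) : Set ↥(finAdelic (↥(maximalRealSubfield L)) L (IsCMField.complexConj L) 2 ((StdForm.antidiagonal 2).over L)))) : Set (quasiSplit (↥(maximalRealSubfield L)) L (IsCMField.complexConj L) 2).Adelic)) → ℂ) ≠ ⊥}) (W' : ClosedSubrep ((quasiSplit (↥(maximalRealSubfield L)) L (IsCMField.complexConj L) 2).rightRegular μ)), W'.toContRep.IsTopIrreducible → W' ≤ residualSubspace (quasiSplit (↥(maximalRealSubfield L)) L (IsCMField.complexConj L) 2) μ 𝔓 →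
        W'.toSubmodule ⊓ (⨅ k : ↥(Subgroup.closure ((Set.range (fun k : ↥(UnitaryGroup.arch (↥(maximalRealSubfield L)) L (IsCMField.complexConj L) 2 ((StdForm.antidiagonal 2).over L) ⊓ unitaryGroupOfForm (conjMixed (↥(maximalRealSubfield L)) L (IsCMField.complexConj L)) 1) => (archToAdelic (↥(maximalRealSubfield L)) L (IsCMField.complexConj L) 2 ((StdForm.antidiagonal 2).over L)) (Subgroup.inclusion inf_le_left k)) ∪
            (finAdelicToAdelic (↥(maximalRealSubfield L)) L (IsCMField.complexConj L) 2 ((StdForm.antidiagonal 2).over L)) '' ((Kf : Subgroup ↥(finAdelic (↥(maximalRealSubfield L)) L (IsCMField.complexConj L) 2 ((StdForm.antidiagonal 2).over L))) : Set ↥(finAdelic (↥(maximalRealSubfield L)) L (IsCMField.complexConj L) 2 ((StdForm.antidiagonal 2).over L)))) : Set (quasiSplit (↥(maximalRealSubfield L)) L (IsCMField.complexConj L) 2).Adelic)), Module.End.eigenspace ((((quasiSplit (↥(maximalRealSubfield L)) L (IsCMField.complexConj L) 2).rightRegular μ) ((Subgroup.closure ((Set.range (fun k : ↥(UnitaryGroup.arch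 (↥(maximalRealSubfield L)) L (IsCMField.complexConj L) 2 ((StdForm.antidiagonal 2).over L) ⊓ unitaryGroupOfForm (conjMixed (↥(maximalRealSubfield L)) L (IsCMField.complexConj L)) 1) => (archToAdelic (↥(maximalRealSubfield L)) L (IsCMField.complexConj L) 2 ((StdForm.antidiagonal 2).over L)) (Subgroup.inclusion inf_le_left k)) ∪
            (finAdelicToAdelic (↥(maximalRealSubfield L)) L (IsCMField.complexConj L) 2 ((StdForm.antidiagonal 2).over L)) '' ((Kf : Subgroup ↥(finAdelic (↥(maximalRealSubfield L)) L (IsCMField.complexConj L) 2 ((StdForm.antidiagonal 2).over L))) : Set ↥(finAdelic (↥(maximalRealSubfield L)) L (IsCMField.complexConj L) 2 ((StdForm.antidiagonal 2).over L)))) : Set (quasiSplit (↥(maximalRealSubfield L)) L (IsCMField.complexConj L) 2).Adelic)).subtype k) : (quasiSplit (↥(maximalRealSubfield L)) L (IsCMField.complexConj L) 2).L2 μ →L[ℂ] (quasiSplit (↥(maximalRealSubfield L)) L (IsCMField.complexConj L) 2).L2 μ) :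
          (quasiSplit (↥(maximalRealSubfield L)) L (IsCMField.complexConj L) 2).L2 μ →ₗ[ℂ] (quasiSplit (↥(maximalRealSubfield L)) L (IsCMField.complexConj L) 2).L2 μ) ((ω) k)) ≤ (resHLine L μ (U Kf ω b) (Subgroup.closure ((Set.range (fun k : ↥(UnitaryGroup.arch (↥(maximalRealSubfield L)) L (IsCMField.complexConj L) 2 ((StdForm.antidiagonal 2).over L) ⊓ unitaryGroupOfForm (conjMixed (↥(maximalRealSubfield L)) L (IsCMField.complexConj L)) 1) => (archToAdelic (↥(maximalRealSubfield L)) L (IsCMField.complexConj L) 2 ((StdForm.antidiagonal 2).over L)) (Subgroup.inclusion inf_le_left k)) ∪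
            (finAdelicToAdelic (↥(maximalRealSubfield L)) L (IsCMField.complexConj L) 2 ((StdForm.antidiagonal 2).over L)) '' ((Kf : Subgroup ↥(finAdelic (↥(maximalRealSubfield L)) L (IsCMField.complexConj L) 2 ((StdForm.antidiagonal 2).over L))) : Set ↥(finAdelic (↥(maximalRealSubfield L)) L (IsCMField.complexConj L) 2 ((StdForm.antidiagonal 2).over L)))) : Set (quasiSplit (↥(maximalRealSubfield L)) L (IsCMField.complexConj L) 2).Adelic)) ω (b : HeckeCharacter L))ᗮ)
    (hL : ∀ (Kf : Subgroup ↥(finAdelic (↥(maximalRealSubfield L)) L (IsCMField.complexConj L) 2 ((StdForm.antidiagonal 2).over L))), IsOpen ((Kf : Subgroup ↥(finAdelic (↥(maximalRealSubfield L)) L (IsCMField.complexConj L) 2 ((StdForm.antidiagonal 2).over L))) : Set ↥(finAdelic (↥(maximalRealSubfield L)) L (IsCMField.complexConj L) 2 ((StdForm.antidiagonal 2).over L))) → Kf ≤ ((((standardMaximalCompactGL 2 L).comap (adelicVal (↥(maximalRealSubfield L)) L (IsCMField.complexConj L) 2 ((StdForm.antidiagonal 2).over L)) : Subgroup (quasiSplit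 (↥(maximalRealSubfield L)) L (IsCMField.complexConj L) 2).Adelic)).comap (finAdelicToAdelic (↥(maximalRealSubfield L)) L (IsCMField.complexConj L) 2 ((StdForm.antidiagonal 2).over L)) : Subgroup ↥(finAdelic (↥(maximalRealSubfield L)) L (IsCMField.complexConj L) 2 ((StdForm.antidiagonal 2).over L))) → ∀ (ω : ↥(Subgroup.closure ((Set.range (fun k : ↥(UnitaryGroup.arch (↥(maximalRealSubfield L)) L (IsCMField.complexConj L) 2 ((StdForm.antidiagonal 2).over L) ⊓ unitaryGroupOfForm (conjMixed (↥(maximalRealSubfield L)) L (IsCMField.complexConj L)) 1) => (archToAdelic (↥(maximalRealSubfield L)) L (IsCMField.complexConj L) 2 ((StdForm.antidiagonal 2).over L)) (Subgroup.inclusion inf_le_left k)) ∪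
            (finAdelicToAdelic (↥(maximalRealSubfield L)) L (IsCMField.complexConj L) 2 ((StdForm.antidiagonal 2).over L)) '' ((Kf : Subgroup ↥(finAdelic (↥(maximalRealSubfield L)) L (IsCMField.complexConj L) 2 ((StdForm.antidiagonal 2).over L))) : Set ↥(finAdelic (↥(maximalRealSubfield L)) L (IsCMField.complexConj L) 2 ((StdForm.antidiagonal 2).over L)))) : Set (quasiSplit (↥(maximalRealSubfield L)) L (IsCMField.complexConj L) 2).Adelic)) →* ℂ), (∀ x, ‖ω x‖ = 1) → Continuous ω →
      ∀ b : ↥{χ : HeckeCharacter L | (∀ r : ℝ≥0ˣ, χ (posRealIdele L r) = 1) ∧ chiSectionSpace χ (Subgroup.closure ((Set.range (fun k : ↥(UnitaryGroup.arch (↥(maximalRealSubfield L)) L (IsCMField.complexConj L) 2 ((StdForm.antidiagonal 2).over L) ⊓ unitaryGroupOfForm (conjMixed (↥(maximalRealSubfield L)) L (IsCMField.complexConj L)) 1) => (archToAdelic (↥(maximalRealSubfield L)) L (IsCMField.complexConj L) 2 ((StdForm.antidiagonal 2).over L)) (Subgroup.inclusion inf_le_left k)) ∪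
            (finAdelicToAdelic (↥(maximalRealSubfield L)) L (IsCMField.complexConj L) 2 ((StdForm.antidiagonal 2).over L)) '' ((Kf : Subgroup ↥(finAdelic (↥(maximalRealSubfield L)) L (IsCMField.complexConj L) 2 ((StdForm.antidiagonal 2).over L))) : Set ↥(finAdelic (↥(maximalRealSubfield L)) L (IsCMField.complexConj L) 2 ((StdForm.antidiagonal 2).over L)))) : Set (quasiSplit (↥(maximalRealSubfield L)) L (IsCMField.complexConj L) 2).Adelic)) ((ω) : ↥(Subgroup.closure ((Set.range (fun k : ↥(UnitaryGroup.arch (↥(maximalRealSubfield L)) L (IsCMField.complexConj L) 2 ((StdForm.antidiagonal 2).over L) ⊓ unitaryGroupOfForm (conjMixed (↥(maximalRealSubfield L)) L (IsCMField.complexConj L)) 1) => (archToAdelic (↥(maximalRealSubfield L)) L (IsCMField.complexConj L) 2 ((StdForm.antidiagonal 2).over L)) (Subgroup.inclusion inf_le_left k)) ∪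
            (finAdelicToAdelic (↥(maximalRealSubfield L)) L (IsCMField.complexConj L) 2 ((StdForm.antidiagonal 2).over L)) '' ((Kf : Subgroup ↥(finAdelic (↥(maximalRealSubfield L)) L (IsCMField.complexConj L) 2 ((StdForm.antidiagonal 2).over L))) : Set ↥(finAdelic (↥(maximalRealSubfield L)) L (IsCMField.complexConj L) 2 ((StdForm.antidiagonal 2).over L)))) : Set (quasiSplit (↥(maximalRealSubfield L)) L (IsCMField.complexConj L) 2).Adelic)) → ℂ) ≠ ⊥}, resHAtom L μ (U Kf ω b) (Subgroup.closure ((Set.range (fun k : ↥(UnitaryGroup.arch (↥(maximalRealSubfield L)) L (IsCMField.complexConj L) 2 ((StdForm.antidiagonal 2).over L) ⊓ unitaryGroupOfForm (conjMixed (↥(maximalRealSubfield L)) L (IsCMField.complexConj L)) 1) => (archToAdelic (↥(maximalRealSubfield L)) L (IsCMField.complexConj L) 2 ((StdForm.antidiagonal 2).over L)) (Subgroup.inclusion inf_le_left k)) ∪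
            (finAdelicToAdelic (↥(maximalRealSubfield L)) L (IsCMField.complexConj L) 2 ((StdForm.antidiagonal 2).over L)) '' ((Kf : Subgroup ↥(finAdelic (↥(maximalRealSubfield L)) L (IsCMField.complexConj L) 2 ((StdForm.antidiagonal 2).over L))) : Set ↥(finAdelic (↥(maximalRealSubfield L)) L (IsCMField.complexConj L) 2 ((StdForm.antidiagonal 2).over L)))) : Set (quasiSplit (↥(maximalRealSubfield L)) L (IsCMField.complexConj L) 2).Adelic)) ω (b : HeckeCharacter L) ≤ (⨆ ψ : {ψ : ↥(TorusDict.torus (IsCMField.complexConj L)) →ₜ* ℂˣ // TorusDict.IsAutomorphic (IsCMField.complexConj L) ψ},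
        (AdelicGroupData.AutomorphicCharacter.lineSubrep (𝒢 := (quasiSplit (↥(maximalRealSubfield L)) L (IsCMField.complexConj L) 2))
          (cmDetChar L 2 ((StdForm.antidiagonal 2).over L) ψ.1 ψ.2 ((Matrix.isUnit_iff_isUnit_det _).mp (StdForm.isUnit_over (StdForm.antidiagonal 2) L)).ne_zero) μ).toSubmodule))
    (P : ClosedSubrep ((quasiSplit (↥(maximalRealSubfield L)) L (IsCMField.complexConj L) 2).rightRegular μ)) (hP : P.toContRep.IsTopIrreducible) (hPres : P ≤ residualSubspace (quasiSplit (↥(maximalRealSubfield L)) L (IsCMField.complexConj L) 2) μ 𝔓) :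
    P.toSubmodule ≤ (⨆ ψ : {ψ : ↥(TorusDict.torus (IsCMField.complexConj L)) →ₜ* ℂˣ // TorusDict.IsAutomorphic (IsCMField.complexConj L) ψ},
        (AdelicGroupData.AutomorphicCharacter.lineSubrep (𝒢 := (quasiSplit (↥(maximalRealSubfield L)) L (IsCMField.complexConj L) 2))
          (cmDetChar L 2 ((StdForm.antidiagonal 2).over L) ψ.1 ψ.2 ((Matrix.isUnit_iff_isUnit_det _).mp (StdForm.isUnit_over (StdForm.antidiagonal 2) L)).ne_zero) μ).toSubmodule).topologicalClosure := by
  -- `K_∞ := U(J₂)(L⁺ ⊗ ℝ) ∩ U(1 ⊗ 1)` is a compact Hausdorff ABELIAN topological group (§0, ★ `compactSpace_archUnitaryPoints`); the structure lives in this proof only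
  letI : CommGroup ↥(UnitaryGroup.arch (↥(maximalRealSubfield L)) L (IsCMField.complexConj L) 2 ((StdForm.antidiagonal 2).over L) ⊓ unitaryGroupOfForm (conjMixed (↥(maximalRealSubfield L)) L (IsCMField.complexConj L)) 1) := { toGroup := inferInstance, mul_comm := fun a b => archUnitaryPoints_mul_comm a b }
  haveI : CompactSpace ↥(UnitaryGroup.arch (↥(maximalRealSubfield L)) L (IsCMField.complexConj L) 2 ((StdForm.antidiagonal 2).over L) ⊓ unitaryGroupOfForm (conjMixed (↥(maximalRealSubfield L)) L (IsCMField.complexConj L)) 1) := compactSpace_archUnitaryPoints ((StdForm.antidiagonal 2).over L)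
  -- (D) ★ p862396 at the κ ∕ K₀ OF RECORD (K₀ open: ★ `isOpen_comap_finAdelicToAdelic_maximalLevel`), over its index `Λ′`
  have hD := le_topologicalClosure_iSup_inf_iso_of_continuous μ (Subgroup.inclusion (inf_le_left : (UnitaryGroup.arch (↥(maximalRealSubfield L)) L (IsCMField.complexConj L) 2 ((StdForm.antidiagonal 2).over L) ⊓ unitaryGroupOfForm (conjMixed (↥(maximalRealSubfield L)) L (IsCMField.complexConj L)) 1) ≤ UnitaryGroup.arch (↥(maximalRealSubfield L)) L (IsCMField.complexConj L) 2 ((StdForm.antidiagonal 2).over L))) P hP (((((standardMaximalCompactGL 2 L).comap (adelicVal (↥(maximalRealSubfield L)) L (IsCMField.complexConj L) 2 ((StdForm.antidiagonal 2).over L)) : Subgroup (quasiSplit (↥(maximalRealSubfield L)) L (IsCMField.complexConj L) 2).Adelic)).comap (finAdelicToAdelic (↥(maximalRealSubfield L)) L (IsCMField.complexConj L) 2 ((StdForm.antidiagonal 2).over L)) : Subgroup ↥(finAdelic (↥(maximalRealSubfield L)) L (IsCMField.complexConj L) 2 ((StdForm.antidiagonal 2).over L))))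
    isOpen_comap_finAdelicToAdelic_maximalLevel (Subgroup.inclusion_injective _) (continuous_inclusion_archUnitaryPoints L)
  -- ★ p862475 (the print, side conditions + `hc` discharged) at `ι := Λ′`, `Kf ℓ := ℓ.1.1`, `ω ℓ := ℓ.2.2.1`, (E_blk) ★ `hEblk_resHAtom_resHLine`, letters read at `(ℓ.1.1, ℓ.2.2.1)`
  exact residual_le_topologicalClosure_iSup_charLines_of_letters_kad L μ 𝔓 hne h𝔓
    (fun ℓ : (Σ Kf : {Kf : Subgroup ↥(finAdelic (↥(maximalRealSubfield L)) L (IsCMField.complexConj L) 2 ((StdForm.antidiagonal 2).over L)) // IsOpen ((Kf : Subgroup ↥(finAdelic (↥(maximalRealSubfield L)) L (IsCMField.complexConj L) 2 ((StdForm.antidiagonal 2).over L))) : Set ↥(finAdelic (↥(maximalRealSubfield L)) L (IsCMField.complexConj L) 2 ((StdForm.antidiagonal 2).over L))) ∧ Kf ≤ ((((standardMaximalCompactGL 2 L).comap (adelicVal (↥(maximalRealSubfield L)) L (IsCMField.complexConj L) 2 ((StdForm.antidiagonal 2).over L)) : Subgroup (quasiSplit (↥(maximalRealSubfield L)) L (IsCMField.complexConj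 L) 2).Adelic)).comap (finAdelicToAdelic (↥(maximalRealSubfield L)) L (IsCMField.complexConj L) 2 ((StdForm.antidiagonal 2).over L)) : Subgroup ↥(finAdelic (↥(maximalRealSubfield L)) L (IsCMField.complexConj L) 2 ((StdForm.antidiagonal 2).over L)))}, Σ χ : PontryaginDual ↥(UnitaryGroup.arch (↥(maximalRealSubfield L)) L (IsCMField.complexConj L) 2 ((StdForm.antidiagonal 2).over L) ⊓ unitaryGroupOfForm (conjMixed (↥(maximalRealSubfield L)) L (IsCMField.complexConj L)) 1),
        {ω : ↥(Subgroup.closure ((Set.range (fun k : ↥(UnitaryGroup.arch (↥(maximalRealSubfield L)) L (IsCMField.complexConj L) 2 ((StdForm.antidiagonal 2).over L) ⊓ unitaryGroupOfForm (conjMixed (↥(maximalRealSubfield L)) L (IsCMField.complexConj L)) 1) => (archToAdelic (↥(maximalRealSubfield L)) L (IsCMField.complexConj L) 2 ((StdForm.antidiagonal 2).over L)) (Subgroup.inclusion inf_le_left k)) ∪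
            (finAdelicToAdelic (↥(maximalRealSubfield L)) L (IsCMField.complexConj L) 2 ((StdForm.antidiagonal 2).over L)) '' ((Kf.1 : Subgroup ↥(finAdelic (↥(maximalRealSubfield L)) L (IsCMField.complexConj L) 2 ((StdForm.antidiagonal 2).over L))) : Set ↥(finAdelic (↥(maximalRealSubfield L)) L (IsCMField.complexConj L) 2 ((StdForm.antidiagonal 2).over L)))) : Set (quasiSplit (↥(maximalRealSubfield L)) L (IsCMField.complexConj L) 2).Adelic)) →* ℂ //
          (∀ k : ↥(UnitaryGroup.arch (↥(maximalRealSubfield L)) L (IsCMField.complexConj L) 2 ((StdForm.antidiagonal 2).over L) ⊓ unitaryGroupOfForm (conjMixed (↥(maximalRealSubfield L)) L (IsCMField.complexConj L)) 1), ω ⟨(archToAdelic (↥(maximalRealSubfield L)) L (IsCMField.complexConj L) 2 ((StdForm.antidiagonal 2).over L)) ((Subgroup.inclusion (inf_le_left : (UnitaryGroup.arch (↥(maximalRealSubfield L)) L (IsCMField.complexConj L) 2 ((StdForm.antidiagonal 2).over L) ⊓ unitaryGroupOfForm (conjMixed (↥(maximalRealSubfield L)) L (IsCMField.complexConj L)) 1)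 ≤ UnitaryGroup.arch (↥(maximalRealSubfield L)) L (IsCMField.complexConj L) 2 ((StdForm.antidiagonal 2).over L))) k), Subgroup.subset_closure (Or.inl ⟨k, rfl⟩)⟩ = ((χ k : Circle) : ℂ)) ∧
          (∀ (u : ↥(finAdelic (↥(maximalRealSubfield L)) L (IsCMField.complexConj L) 2 ((StdForm.antidiagonal 2).over L))) (hu : u ∈ Kf.1), ω ⟨(finAdelicToAdelic (↥(maximalRealSubfield L)) L (IsCMField.complexConj L) 2 ((StdForm.antidiagonal 2).over L)) u, Subgroup.subset_closure (Or.inr ⟨u, hu, rfl⟩)⟩ = 1) ∧ (∀ x, ‖ω x‖ = 1) ∧ Continuous ω}) => (ℓ.1.1 : Subgroup ↥(finAdelic (↥(maximalRealSubfield L)) L (IsCMField.complexConj L) 2 ((StdForm.antidiagonal 2).over L)))) (fun ℓ => ℓ.1.2.1) (fun ℓ u hu => coe_mem_glFiniteIntegralLevel_of_mem_maximalLevelFin L u (ℓ.1.2.2 hu))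
    (fun ℓ => ℓ.2.2.1) (fun ℓ => ℓ.2.2.2.2.2.1) (fun ℓ => ℓ.2.2.2.2.2.2) P hP hPres
    (fun ℓ b => resHAtom L μ (U ℓ.1.1 ℓ.2.2.1 b) (Subgroup.closure ((Set.range (fun k : ↥(UnitaryGroup.arch (↥(maximalRealSubfield L)) L (IsCMField.complexConj L) 2 ((StdForm.antidiagonal 2).over L) ⊓ unitaryGroupOfForm (conjMixed (↥(maximalRealSubfield L)) L (IsCMField.complexConj L)) 1) => (archToAdelic (↥(maximalRealSubfield L)) L (IsCMField.complexConj L) 2 ((StdForm.antidiagonal 2).over L)) (Subgroup.inclusion inf_le_left k)) ∪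
            (finAdelicToAdelic (↥(maximalRealSubfield L)) L (IsCMField.complexConj L) 2 ((StdForm.antidiagonal 2).over L)) '' ((ℓ.1.1 : Subgroup ↥(finAdelic (↥(maximalRealSubfield L)) L (IsCMField.complexConj L) 2 ((StdForm.antidiagonal 2).over L))) : Set ↥(finAdelic (↥(maximalRealSubfield L)) L (IsCMField.complexConj L) 2 ((StdForm.antidiagonal 2).over L)))) : Set (quasiSplit (↥(maximalRealSubfield L)) L (IsCMField.complexConj L) 2).Adelic)) ℓ.2.2.1 (b : HeckeCharacter L))
    (fun ℓ b => resHLine L μ (U ℓ.1.1 ℓ.2.2.1 b) (Subgroup.closure ((Set.range (fun k : ↥(UnitaryGroup.arch (↥(maximalRealSubfield L)) L (IsCMField.complexConj L) 2 ((StdForm.antidiagonal 2).over L) ⊓ unitaryGroupOfForm (conjMixed (↥(maximalRealSubfield L)) L (IsCMField.complexConj L)) 1) => (archToAdelic (↥(maximalRealSubfield L)) L (IsCMField.complexConj L) 2 ((StdForm.antidiagonal 2).over L)) (Subgroup.inclusion inf_le_left k)) ∪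
            (finAdelicToAdelic (↥(maximalRealSubfield L)) L (IsCMField.complexConj L) 2 ((StdForm.antidiagonal 2).over L)) '' ((ℓ.1.1 : Subgroup ↥(finAdelic (↥(maximalRealSubfield L)) L (IsCMField.complexConj L) 2 ((StdForm.antidiagonal 2).over L))) : Set ↥(finAdelic (↥(maximalRealSubfield L)) L (IsCMField.complexConj L) 2 ((StdForm.antidiagonal 2).over L)))) : Set (quasiSplit (↥(maximalRealSubfield L)) L (IsCMField.complexConj L) 2).Adelic)) ℓ.2.2.1 (b : HeckeCharacter L))
    hD (hEblk_resHAtom_resHLine L μ (fun ℓ : (Σ Kf : {Kf : Subgroup ↥(finAdelic (↥(maximalRealSubfield L)) L (IsCMField.complexConj L) 2 ((StdForm.antidiagonal 2).over L)) // IsOpen ((Kf : Subgroup ↥(finAdelic (↥(maximalRealSubfield L)) L (IsCMField.complexConj L) 2 ((StdForm.antidiagonal 2).over L))) : Set ↥(finAdelic (↥(maximalRealSubfield L)) L (IsCMField.complexConj L) 2 ((StdForm.antidiagonal 2).over L))) ∧ Kf ≤ ((((standardMaximalCompactGL 2 L).comap (adelicVal (↥(maximalRealSubfield L)) L (IsCMField.complexConj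 L) 2 ((StdForm.antidiagonal 2).over L)) : Subgroup (quasiSplit (↥(maximalRealSubfield L)) L (IsCMField.complexConj L) 2).Adelic)).comap (finAdelicToAdelic (↥(maximalRealSubfield L)) L (IsCMField.complexConj L) 2 ((StdForm.antidiagonal 2).over L)) : Subgroup ↥(finAdelic (↥(maximalRealSubfield L)) L (IsCMField.complexConj L) 2 ((StdForm.antidiagonal 2).over L)))}, Σ χ : PontryaginDual ↥(UnitaryGroup.arch (↥(maximalRealSubfield L)) L (IsCMField.complexConj L) 2 ((StdForm.antidiagonal 2).over L) ⊓ unitaryGroupOfForm (conjMixed (↥(maximalRealSubfield L)) L (IsCMField.complexConj L)) 1),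
        {ω : ↥(Subgroup.closure ((Set.range (fun k : ↥(UnitaryGroup.arch (↥(maximalRealSubfield L)) L (IsCMField.complexConj L) 2 ((StdForm.antidiagonal 2).over L) ⊓ unitaryGroupOfForm (conjMixed (↥(maximalRealSubfield L)) L (IsCMField.complexConj L)) 1) => (archToAdelic (↥(maximalRealSubfield L)) L (IsCMField.complexConj L) 2 ((StdForm.antidiagonal 2).over L)) (Subgroup.inclusion inf_le_left k)) ∪
            (finAdelicToAdelic (↥(maximalRealSubfield L)) L (IsCMField.complexConj L) 2 ((StdForm.antidiagonal 2).over L)) '' ((Kf.1 : Subgroup ↥(finAdelic (↥(maximalRealSubfield L)) L (IsCMField.complexConj L) 2 ((StdForm.antidiagonal 2).over L))) : Set ↥(finAdelic (↥(maximalRealSubfield L)) L (IsCMField.complexConj L) 2 ((StdForm.antidiagonal 2).over L)))) : Set (quasiSplit (↥(maximalRealSubfield L)) L (IsCMField.complexConj L) 2).Adelic)) →* ℂ //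
          (∀ k : ↥(UnitaryGroup.arch (↥(maximalRealSubfield L)) L (IsCMField.complexConj L) 2 ((StdForm.antidiagonal 2).over L) ⊓ unitaryGroupOfForm (conjMixed (↥(maximalRealSubfield L)) L (IsCMField.complexConj L)) 1), ω ⟨(archToAdelic (↥(maximalRealSubfield L)) L (IsCMField.complexConj L) 2 ((StdForm.antidiagonal 2).over L)) ((Subgroup.inclusion (inf_le_left : (UnitaryGroup.arch (↥(maximalRealSubfield L)) L (IsCMField.complexConj L) 2 ((StdForm.antidiagonal 2).over L) ⊓ unitaryGroupOfForm (conjMixed (↥(maximalRealSubfield L)) L (IsCMField.complexConj L)) 1) ≤ UnitaryGroup.arch (↥(maximalRealSubfield L)) L (IsCMField.complexConj L) 2 ((StdForm.antidiagonal 2).over L))) k), Subgroup.subset_closure (Or.inl ⟨k, rfl⟩)⟩ = ((χ k : Circle) : ℂ)) ∧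
          (∀ (u : ↥(finAdelic (↥(maximalRealSubfield L)) L (IsCMField.complexConj L) 2 ((StdForm.antidiagonal 2).over L))) (hu : u ∈ Kf.1), ω ⟨(finAdelicToAdelic (↥(maximalRealSubfield L)) L (IsCMField.complexConj L) 2 ((StdForm.antidiagonal 2).over L)) u, Subgroup.subset_closure (Or.inr ⟨u, hu, rfl⟩)⟩ = 1) ∧ (∀ x, ‖ω x‖ = 1) ∧ Continuous ω}) => Subgroup.closure ((Set.range (fun k : ↥(UnitaryGroup.arch (↥(maximalRealSubfield L)) L (IsCMField.complexConj L) 2 ((StdForm.antidiagonal 2).over L) ⊓ unitaryGroupOfForm (conjMixed (↥(maximalRealSubfield L)) L (IsCMField.complexConj L)) 1) => (archToAdelic (↥(maximalRealSubfield L)) L (IsCMField.complexConj L) 2 ((StdForm.antidiagonal 2).over L)) (Subgroup.inclusion inf_le_left k)) ∪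
            (finAdelicToAdelic (↥(maximalRealSubfield L)) L (IsCMField.complexConj L) 2 ((StdForm.antidiagonal 2).over L)) '' ((ℓ.1.1 : Subgroup ↥(finAdelic (↥(maximalRealSubfield L)) L (IsCMField.complexConj L) 2 ((StdForm.antidiagonal 2).over L))) : Set ↥(finAdelic (↥(maximalRealSubfield L)) L (IsCMField.complexConj L) 2 ((StdForm.antidiagonal 2).over L)))) : Set (quasiSplit (↥(maximalRealSubfield L)) L (IsCMField.complexConj L) 2).Adelic)) (fun ℓ => ℓ.2.2.1) (fun ℓ b => U ℓ.1.1 ℓ.2.2.1 b))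
    (fun ℓ => hO ℓ.1.1 ℓ.1.2.1 ℓ.1.2.2 ℓ.2.2.1 ℓ.2.2.2.2.2.1 ℓ.2.2.2.2.2.2) (fun ℓ b => hN ℓ.1.1 ℓ.1.2.1 ℓ.1.2.2 ℓ.2.2.1 ℓ.2.2.2.2.2.1 ℓ.2.2.2.2.2.2 b)
    (fun ℓ b => hL ℓ.1.1 ℓ.1.2.1 ℓ.1.2.2 ℓ.2.2.1 ℓ.2.2.2.2.2.1 ℓ.2.2.2.2.2.2 b)

end CMTwo

end Summit.HodgeConjecture.HodgeConjecture.R90.S8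

end
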